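import Mathlib
import Summits.KontsevichZagierPeriods.Zeta5Search.CatalanTwoAdicXi
import Summits.KontsevichZagierPeriods.Zeta5Search.CatalanTwoAdicTelescope
import Summits.KontsevichZagierPeriods.Zeta5Search.Denom.CatalanRayAtoms
import HarnessLib

/-!
# The Lemma-S atoms hold in `ℚ₂` with `G ↦ ξ` — analytic heart of the 2-adic transfer (K5a), kernel form

HONEST FRAMING: systematic search; no irrationality claim unless certified.  pub-zeta5 fam-catalan gen 2
(families/catalan/TWOADIC.md §7 F13a, §8 (2); fam-denom CATK1 Lemma S, tree `Denom.CatalanRayAtoms`).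
The partial-fraction reduction of the Catalan box forms (over ℝ: `J = Q·G + P`) consumes exactly the series
`S₁(a) = Σ_{ν≥0} t_ν/(ν+½+a)`, `S₂(a) = Σ_{ν≥0} t_ν/(ν+½+a)²` (`a ∈ ℤ`, `t_ν = 2·4^ν(ν!)²/(2ν+1)!`) with the closed
forms of CATK1 Lemma S: `S₁(a) = 2t_{a−1}σ(a)` (`a ≥ 1`, rational), `S₁(−c) = 8C(2c,c)4^{−c}(G − gsum(c))`,
`S₂(a) = t_{a−1}(W(a) − 8G)` (`a ≥ 1`).  Since `v₂(t_ν) → ∞` the same series converge in `ℚ₂`, and THIS FILE PROVES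
all three closed forms there VERBATIM with `G` replaced by `ξ = (1/8)Σ^{(2)} t_μ/(μ+½)` (`CatalanTwoAdicXi.xi`):
`S1_succ`, `S2_succ` (the recursions in `a`: index shift `t_{ν−1} = t_ν(2ν+1)/(2ν)`, partial fractions, and the
ONE universal constant `Σ_{ν≥1} t_ν/ν = 4`, true in `ℚ₂` by the tree's `hasSum_tB_div_two_adic`), then
`S1_nat : S1 a = 2·t_{a−1}·σ(a)`, `S1_neg : S1 (−c) = 8C(2c,c)/4^c·(ξ − gsum c)`, `S2_nat : S2 a = t_{a−1}·(W(a) − 8ξ)`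
over fam-denom's atoms `sigmaAtom`, `gsumAtom`, `Watom` BY NAME.  These are F13a's 'input identities'
(`S₂(1) = 16 − 16ξ`, `2S₁(−1) = S₁(0) − 4`, …; observed there to 400–500 bits) as kernel theorems; with them the
2-adic identity `J2 = P^{closed} + ξ·Q` for fam-denom's explicit rational part (`Denom.CatalanRayPClosed`) is a
FINITE computation (partial fractions of `R_n` + linearity) — task T-A2 of the intrinsic chain
(`CatalanTwoAdicRay.ray_measure_intrinsic`).  Nothing here mentions `G`, `Jsym` or irrationality.  0 sorry.
-/

open Finset Filter

namespace Summit.KontsevichZagierPeriods.Zeta5Search.CatalanTwoAdicSeries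

open Summit.KontsevichZagierPeriods.Zeta5Search.Denom.CatalanRayAtoms

/-! ### The series `S₁(a)`, `S₂(a)` in `ℚ₂` -/

/-- `ν`-th term of `S₁(a)`: `t_ν/(ν+½+a) = 2t_ν/(2ν+2a+1)`. -/
def s1Term (a : ℤ) (ν : ℕ) : ℚ := 2 * tB ν / (2 * ν + 2 * a + 1)

/-- `ν`-th term of `S₂(a)`: `t_ν/(ν+½+a)² = 4t_ν/(2ν+2a+1)²`. -/
def s2Term (a : ℤ) (ν : ℕ) : ℚ := 4 * tB ν / (2 * ν + 2 * a + 1) ^ 2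

/-- The denominators are odd integers, hence non-zero … -/
theorem oddDen_ne_zero (a : ℤ) (ν : ℕ) : (2 * (ν : ℚ) + 2 * a + 1) ≠ 0 := by
  have h : ((2 * (ν : ℤ) + 2 * a + 1 : ℤ) : ℚ) ≠ 0 := by
    exact_mod_cast (by omega : (2 * (ν : ℤ) + 2 * a + 1) ≠ 0)
  push_cast at h
  exact h

/-- … and 2-adic units. -/
theorem norm_oddDen (a : ℤ) (ν : ℕ) : ‖(((2 * (ν : ℚ) + 2 * a + 1 : ℚ) : ℚ_[2]))‖ = 1 := by
  have hk : (((2 * (ν : ℚ) + 2 * a + 1 : ℚ) : ℚ_[2])) = ((2 * (ν : ℤ) + 2 * a + 1 : ℤ) : ℚ_[2]) := by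
    push_cast; ring
  rw [hk]
  refine le_antisymm (Padic.norm_int_le_one _) ?_
  by_contra hlt
  rw [not_le, Padic.norm_intCast_lt_one_iff] at hlt
  push_cast at hlt
  omega

/-- `‖2‖₂ = 1/2`. -/
theorem norm_two_padic : ‖(2 : ℚ_[2])‖ = 1 / 2 := by
  have := @Padic.norm_p 2 _; push_cast at this; rw [this]; norm_num

/-- `‖2t_ν/(2ν+2a+1)‖₂ ≤ (1/2)^(ν+1)`. -/
theorem norm_s1Term_le (a : ℤ) (ν : ℕ) : ‖((s1Term a ν : ℚ) : ℚ_[2])‖ ≤ ((1 : ℝ) / 2) ^ (ν + 1) := by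
  have hd := norm_oddDen a ν
  unfold s1Term
  push_cast
  rw [norm_div, norm_mul, norm_two_padic]
  push_cast at hd
  rw [hd, div_one]
  have := norm_tB_le ν
  have h0 : (0 : ℝ) ≤ ‖((tB ν : ℚ) : ℚ_[2])‖ := norm_nonneg _
  nlinarith

/-- `‖4t_ν/(2ν+2a+1)²‖₂ ≤ (1/2)^(ν+1)`. -/
theorem norm_s2Term_le (a : ℤ) (ν : ℕ) : ‖((s2Term a ν : ℚ) : ℚ_[2])‖ ≤ ((1 : ℝ) / 2) ^ (ν + 1) := by
  have hd := norm_oddDen a ν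
  unfold s2Term
  push_cast
  rw [norm_div, norm_mul, norm_pow]
  push_cast at hd
  rw [hd, one_pow, div_one, show (4 : ℚ_[2]) = 2 * 2 by norm_num, norm_mul, norm_two_padic]
  have := norm_tB_le ν
  have h0 : (0 : ℝ) ≤ ‖((tB ν : ℚ) : ℚ_[2])‖ := norm_nonneg _
  nlinarith

/-- `(1/2)^(N+1) → 0`. -/
theorem tendsto_half_pow : Tendsto (fun N : ℕ => ((1 : ℝ) / 2) ^ (N + 1)) atTop (nhds 0) := by
  have := (tendsto_pow_atTop_nhds_zero_of_lt_one (by norm_num : (0 : ℝ) ≤ 1 / 2) (by norm_num)).mul_const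
    ((1 : ℝ) / 2)
  simpa [pow_succ] using this

/-- the series `S₁(a)` is summable in `ℚ₂`. -/
theorem summable_s1Term (a : ℤ) : Summable fun ν => ((s1Term a ν : ℚ) : ℚ_[2]) := by
  refine NonarchimedeanAddGroup.summable_of_tendsto_cofinite_zero ?_
  rw [Nat.cofinite_eq_atTop, tendsto_zero_iff_norm_tendsto_zero]
  exact squeeze_zero (fun N => norm_nonneg _) (norm_s1Term_le a) tendsto_half_pow

/-- the series `S₂(a)` is summable in `ℚ₂`. -/
theorem summable_s2Term (a : ℤ) : Summable fun ν => ((s2Term a ν : ℚ) : ℚ_[2]) := by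
  refine NonarchimedeanAddGroup.summable_of_tendsto_cofinite_zero ?_
  rw [Nat.cofinite_eq_atTop, tendsto_zero_iff_norm_tendsto_zero]
  exact squeeze_zero (fun N => norm_nonneg _) (norm_s2Term_le a) tendsto_half_pow

/-- `S₁(a) := Σ^{(2)}_{ν≥0} t_ν/(ν+½+a) ∈ ℚ₂`. -/
noncomputable def S1 (a : ℤ) : ℚ_[2] := ∑' ν, ((s1Term a ν : ℚ) : ℚ_[2])

/-- `S₂(a) := Σ^{(2)}_{ν≥0} t_ν/(ν+½+a)² ∈ ℚ₂`. -/
noncomputable def S2 (a : ℤ) : ℚ_[2] := ∑' ν, ((s2Term a ν : ℚ) : ℚ_[2])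

/-- `HasSum` form of the definition of `S₁(a)`. -/
theorem hasSum_S1 (a : ℤ) : HasSum (fun ν => ((s1Term a ν : ℚ) : ℚ_[2])) (S1 a) := (summable_s1Term a).hasSum
/-- `HasSum` form of the definition of `S₂(a)`. -/
theorem hasSum_S2 (a : ℤ) : HasSum (fun ν => ((s2Term a ν : ℚ) : ℚ_[2])) (S2 a) := (summable_s2Term a).hasSum

/-- `S₁(0) = 8ξ` (definition of `ξ`). -/
theorem S1_zero : S1 0 = 8 * xi := by
  have h := hasSum_xi
  have heq : (fun μ => ((xiTerm μ : ℚ) : ℚ_[2])) = fun μ => ((s1Term 0 μ : ℚ) : ℚ_[2]) := by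
    funext μ
    congr 1
    unfold xiTerm s1Term
    have : ((μ : ℚ) + 1 / 2) ≠ 0 := by positivity
    have h2 := oddDen_ne_zero 0 μ
    push_cast at h2 ⊢
    field_simp
    ring
  rw [heq] at h
  exact (hasSum_S1 0).unique h

/-! ### The recursions in `a` (TWOADIC §8 (2)) -/

/-- `2a+1 ≠ 0` in `ℚ`. -/
theorem twoA_add_one_ne_zero (a : ℤ) : (2 * (a : ℚ) + 1) ≠ 0 := by
  have h := oddDen_ne_zero a 0; push_cast at h; simpa using h

/-- `2a+1 ≠ 0` in `ℚ₂`. -/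
theorem twoA_add_one_ne_zero' (a : ℤ) : (2 * (a : ℚ_[2]) + 1) ≠ 0 := by
  have h : ((2 * a + 1 : ℤ) : ℚ_[2]) ≠ 0 := Int.cast_ne_zero.mpr (by omega)
  push_cast at h; exact h

/-- termwise identity behind `S1_succ`: `2t_ν/(2ν+2a+3) = (1/(2a+1))·t_{ν+1}/(ν+1) + (2a/(2a+1))·2t_{ν+1}/(2ν+2a+3)`. -/
theorem s1Term_succ (a : ℤ) (ν : ℕ) :
    s1Term (a + 1) ν = 1 / (2 * a + 1) * (tB (ν + 1) / (ν + 1 : ℚ)) + 2 * a / (2 * a + 1) * s1Term a (ν + 1) := by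
  unfold s1Term
  rw [tB_succ]
  have h1 : (2 * (ν : ℚ) + 2 * a + 3) ≠ 0 := by
    have h := oddDen_ne_zero (a + 1) ν; push_cast at h; convert h using 1; ring
  have h2 := twoA_add_one_ne_zero a
  have h3 : ((ν : ℚ) + 1) ≠ 0 := by positivity
  have h4 : (2 * (ν : ℚ) + 3) ≠ 0 := by positivity
  have e1 : (2 * (ν : ℚ) + 2 * (((a + 1 : ℤ) : ℚ)) + 1) = 2 * ν + 2 * a + 3 := by push_cast; ring
  have e2 : (2 * (((ν + 1 : ℕ) : ℚ)) + 2 * a + 1) = 2 * ν + 2 * a + 3 := by push_cast; ring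
  have h1' : (2 * ((ν : ℚ) + a) + 3) ≠ 0 := by convert h1 using 1; ring
  rw [e1, e2]; field_simp; ring

/-- termwise identity behind `S2_succ`. -/
theorem s2Term_succ (a : ℤ) (ν : ℕ) :
    s2Term (a + 1) ν = 2 / (2 * a + 1) ^ 2 * (tB (ν + 1) / (ν + 1 : ℚ))
      - 2 / (2 * a + 1) ^ 2 * s1Term a (ν + 1) + 2 * a / (2 * a + 1) * s2Term a (ν + 1) := by
  unfold s1Term s2Term
  rw [tB_succ]
  have h1 : (2 * (ν : ℚ) + 2 * a + 3) ≠ 0 := by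
    have h := oddDen_ne_zero (a + 1) ν; push_cast at h; convert h using 1; ring
  have h2 := twoA_add_one_ne_zero a
  have h3 : ((ν : ℚ) + 1) ≠ 0 := by positivity
  have h4 : (2 * (ν : ℚ) + 3) ≠ 0 := by positivity
  have e1 : (2 * (ν : ℚ) + 2 * (((a + 1 : ℤ) : ℚ)) + 1) = 2 * ν + 2 * a + 3 := by push_cast; ring
  have e2 : (2 * (((ν + 1 : ℕ) : ℚ)) + 2 * a + 1) = 2 * ν + 2 * a + 3 := by push_cast; ring
  have h1' : (2 * ((ν : ℚ) + a) + 3) ≠ 0 := by convert h1 using 1; ring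
  rw [e1, e2]; field_simp; ring

/-- `s1Term a 0 = 4/(2a+1)`. -/
theorem s1Term_zero (a : ℤ) : s1Term a 0 = 4 / (2 * a + 1) := by
  unfold s1Term; rw [tB_zero]; push_cast; ring

/-- `s2Term a 0 = 8/(2a+1)²`. -/
theorem s2Term_zero (a : ℤ) : s2Term a 0 = 8 / (2 * a + 1) ^ 2 := by
  unfold s2Term; rw [tB_zero]; push_cast; ring

/-- **Recursion for `S₁`** (valid for every `a ∈ ℤ`, in `ℚ₂`):
`S₁(a+1) = 4/(2a+1) + (2a/(2a+1))·S₁(a) − 8a/(2a+1)²`. -/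
theorem S1_succ (a : ℤ) :
    S1 (a + 1) = 4 / (2 * (a : ℚ_[2]) + 1) + 2 * a / (2 * a + 1) * S1 a - 8 * a / (2 * a + 1) ^ 2 := by
  have hshift := (hasSum_nat_add_iff' 1).mpr (hasSum_S1 a)
  have hT := hasSum_tB_div_two_adic
  have hcomb := (hT.mul_left ((1 / (2 * a + 1) : ℚ) : ℚ_[2])).add
    (hshift.mul_left ((2 * a / (2 * a + 1) : ℚ) : ℚ_[2]))
  have heq : (fun ν => ((s1Term (a + 1) ν : ℚ) : ℚ_[2]))
      = fun ν => ((1 / (2 * a + 1) : ℚ) : ℚ_[2]) * ((tB (ν + 1) / (ν + 1 : ℚ) : ℚ) : ℚ_[2])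
          + ((2 * a / (2 * a + 1) : ℚ) : ℚ_[2]) * ((s1Term a (ν + 1) : ℚ) : ℚ_[2]) := by
    funext ν; rw [s1Term_succ]; push_cast; ring
  have hsum : HasSum (fun ν => ((s1Term (a + 1) ν : ℚ) : ℚ_[2])) _ := heq ▸ hcomb
  rw [(hasSum_S1 (a + 1)).unique hsum, Finset.sum_range_one, s1Term_zero]
  have h2 := twoA_add_one_ne_zero' a
  push_cast
  field_simp
  ring

/-- **Recursion for `S₂`** (every `a ∈ ℤ`, in `ℚ₂`):
`S₂(a+1) = (2a/(2a+1))·S₂(a) − (2/(2a+1)²)·S₁(a) + 8/(2a+1)² + (8−16a)/(2a+1)³`. -/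
theorem S2_succ (a : ℤ) :
    S2 (a + 1) = 2 * a / (2 * (a : ℚ_[2]) + 1) * S2 a - 2 / (2 * a + 1) ^ 2 * S1 a
      + 8 / (2 * a + 1) ^ 2 + (8 - 16 * a) / (2 * a + 1) ^ 3 := by
  have hshift1 := (hasSum_nat_add_iff' 1).mpr (hasSum_S1 a)
  have hshift2 := (hasSum_nat_add_iff' 1).mpr (hasSum_S2 a)
  have hT := hasSum_tB_div_two_adic
  have hcomb := ((hT.mul_left ((2 / (2 * a + 1) ^ 2 : ℚ) : ℚ_[2])).sub
    (hshift1.mul_left ((2 / (2 * a + 1) ^ 2 : ℚ) : ℚ_[2]))).add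
    (hshift2.mul_left ((2 * a / (2 * a + 1) : ℚ) : ℚ_[2]))
  have heq : (fun ν => ((s2Term (a + 1) ν : ℚ) : ℚ_[2]))
      = fun ν => ((2 / (2 * a + 1) ^ 2 : ℚ) : ℚ_[2]) * ((tB (ν + 1) / (ν + 1 : ℚ) : ℚ) : ℚ_[2])
          - ((2 / (2 * a + 1) ^ 2 : ℚ) : ℚ_[2]) * ((s1Term a (ν + 1) : ℚ) : ℚ_[2])
          + ((2 * a / (2 * a + 1) : ℚ) : ℚ_[2]) * ((s2Term a (ν + 1) : ℚ) : ℚ_[2]) := by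
    funext ν; rw [s2Term_succ]; push_cast; ring
  have hsum : HasSum (fun ν => ((s2Term (a + 1) ν : ℚ) : ℚ_[2])) _ := heq ▸ hcomb
  rw [(hasSum_S2 (a + 1)).unique hsum, Finset.sum_range_one, Finset.sum_range_one, s1Term_zero, s2Term_zero]
  have h2 := twoA_add_one_ne_zero' a
  push_cast
  field_simp
  ring

/-! ### The closed forms (CATK1 Lemma S) in `ℚ₂` -/

/-- `t_a · C(2a,a) = 2·4^a/(2a+1)`. -/
theorem tB_mul_centralBinom (a : ℕ) : tB a * (Nat.choose (2 * a) a : ℚ) = 2 * 4 ^ a / (2 * a + 1) := by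
  have h1 : ((Nat.choose (2 * a) a : ℕ) : ℚ) * (a.factorial : ℚ) * (a.factorial : ℚ) = ((2 * a).factorial : ℚ) := by
    have h := Nat.choose_mul_factorial_mul_factorial (show a ≤ 2 * a by omega)
    rw [show 2 * a - a = a by omega] at h
    exact_mod_cast h
  have h2 : (((2 * a + 1).factorial : ℕ) : ℚ) = (2 * a + 1) * ((2 * a).factorial : ℚ) := by
    rw [Nat.factorial_succ]; push_cast; ring
  have hne : (2 * (a : ℚ) + 1) ≠ 0 := by positivity
  have hf : (((2 * a + 1).factorial : ℕ) : ℚ) ≠ 0 := by positivity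
  unfold tB
  rw [div_mul_eq_mul_div, div_eq_div_iff hf hne, h2, ← h1]
  ring

/-- `t_{a-1} · a · C(2a,a) = 4^a` for `a ≥ 1`. -/
theorem tB_pred_mul_choose (a : ℕ) (ha : 1 ≤ a) : tB (a - 1) * a * (Nat.choose (2 * a) a : ℚ) = 4 ^ a := by
  obtain ⟨b, rfl⟩ : ∃ b, a = b + 1 := ⟨a - 1, by omega⟩
  rw [show b + 1 - 1 = b by omega]
  have hcb : ((b : ℚ) + 1) * (Nat.choose (2 * (b + 1)) (b + 1) : ℚ) = 2 * (2 * b + 1) * (Nat.choose (2 * b) b : ℚ) := by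
    have h1 := Nat.succ_mul_centralBinom_succ b
    rw [Nat.centralBinom_eq_two_mul_choose, Nat.centralBinom_eq_two_mul_choose] at h1
    rw [show 2 * (b + 1) = 2 * b + 2 by ring]; exact_mod_cast h1
  have hc := tB_mul_centralBinom b
  have hne : (2 * (b : ℚ) + 1) ≠ 0 := by positivity
  rw [eq_div_iff hne] at hc
  push_cast
  rw [mul_assoc, hcb, pow_succ]
  linear_combination (2 : ℚ) * hc

/-- `t_a = t_{a-1} · 2a/(2a+1)` for `a ≥ 1`. -/
theorem tB_eq_pred (a : ℕ) (ha : 1 ≤ a) : tB a = tB (a - 1) * (2 * a) / (2 * a + 1) := by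
  obtain ⟨b, rfl⟩ : ∃ b, a = b + 1 := ⟨a - 1, by omega⟩
  rw [show b + 1 - 1 = b by omega, tB_succ]
  push_cast
  have : (2 * (b : ℚ) + 3) ≠ 0 := by positivity
  congr 1 <;> ring

/-- cast forms in `ℚ₂` of the two previous facts -/
theorem cast_tB_eq_pred (a : ℕ) (ha : 1 ≤ a) :
    ((tB a : ℚ) : ℚ_[2]) = ((tB (a - 1) : ℚ) : ℚ_[2]) * (2 * a) / (2 * a + 1) := by
  rw [tB_eq_pred a ha]; push_cast; ring

/-- a positive natural number is non-zero in `ℚ₂`. -/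
theorem natCast_ne_zero_padic (a : ℕ) (ha : 1 ≤ a) : (a : ℚ_[2]) ≠ 0 := by
  have h' : ((a : ℤ) : ℚ_[2]) ≠ 0 := Int.cast_ne_zero.mpr (by omega)
  push_cast at h'; exact h'

/-- `2a+1 ≠ 0` in `ℚ₂` (`a : ℕ`). -/
theorem twoN_add_one_ne_zero_padic (a : ℕ) : (2 * (a : ℚ_[2]) + 1) ≠ 0 := by
  have h' : ((2 * (a : ℤ) + 1 : ℤ) : ℚ_[2]) ≠ 0 := Int.cast_ne_zero.mpr (by omega)
  push_cast at h'; exact h'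

/-- `t_a ≠ 0` in `ℚ₂`. -/
theorem cast_tB_ne_zero (a : ℕ) : ((tB a : ℚ) : ℚ_[2]) ≠ 0 := by exact_mod_cast tB_ne_zero a

/-- `C(2a,a) = 4^a/(t_{a-1}·a)` in `ℚ₂` (`a ≥ 1`). -/
theorem cast_choose_eq (a : ℕ) (ha : 1 ≤ a) :
    ((Nat.choose (2 * a) a : ℕ) : ℚ_[2]) = 4 ^ a / (((tB (a - 1) : ℚ) : ℚ_[2]) * a) := by
  have h := congrArg (fun q : ℚ => ((q : ℚ) : ℚ_[2])) (tB_pred_mul_choose a ha)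
  push_cast at h
  rw [eq_div_iff (mul_ne_zero (cast_tB_ne_zero _) (natCast_ne_zero_padic a ha)), ← h]
  ring

/-- **`S₁(a) = 2 t_{a−1} σ(a)` for `a ≥ 1`** (rational: no `ξ`). -/
theorem S1_nat (a : ℕ) (ha : 1 ≤ a) : S1 a = ((2 * tB (a - 1) * sigmaAtom a : ℚ) : ℚ_[2]) := by
  induction a, ha using Nat.le_induction with
  | base =>
    have h := S1_succ 0
    have hs : sigmaAtom 1 = 1 := sigmaAtom_small.2.1
    norm_num at h ⊢
    rw [h, tB_zero, hs]; norm_num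
  | succ a ha ih =>
    have h := S1_succ a
    have hs : sigmaAtom (a + 1) = sigmaAtom a + (Nat.choose (2 * a) a : ℚ) / ((4 ^ a * (2 * a + 1) : ℕ) : ℚ) := by
      unfold sigmaAtom; rw [Finset.sum_range_succ]
    have hs' := congrArg (fun q : ℚ => ((q : ℚ) : ℚ_[2])) hs
    push_cast at h ih hs' ⊢
    rw [h, ih, hs', cast_choose_eq a ha, cast_tB_eq_pred a ha]
    have h1 := cast_tB_ne_zero (a - 1)
    have h2 := natCast_ne_zero_padic a ha
    have h3 := twoN_add_one_ne_zero_padic a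
    have h4 : ((4 : ℚ_[2]) ^ a) ≠ 0 := pow_ne_zero _ (by norm_num)
    field_simp; ring

/-- **`S₁(−c) = 8C(2c,c)4^{−c}·(ξ − gsum(c))`** for every `c ≥ 0`. -/
theorem S1_neg (c : ℕ) :
    S1 (-(c : ℤ)) = 8 * ((Nat.choose (2 * c) c : ℕ) : ℚ_[2]) / 4 ^ c * (xi - ((gsumAtom c : ℚ) : ℚ_[2])) := by
  induction c with
  | zero =>
    have : gsumAtom 0 = 0 := gsumAtom_small.1
    simp [this, S1_zero]
  | succ c ih =>
    -- the recursion at `a = −(c+1)` reads `S₁(−c) = A + k·S₁(−(c+1)) − B`; the closed form `F` satisfies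
    -- `F(c) = A + k·F(c+1) − B` identically in `ξ`; cancel `k ≠ 0`.
    have h := S1_succ (-((c : ℤ) + 1))
    rw [show (-((c : ℤ) + 1) + 1) = -(c : ℤ) by ring, ih] at h
    push_cast at h ⊢
    have hg : gsumAtom (c + 1) = gsumAtom c
        + ((4 ^ c : ℕ) : ℚ) / ((2 * (2 * c + 1) ^ 2 * Nat.choose (2 * c) c : ℕ) : ℚ) := by
      unfold gsumAtom; rw [Finset.sum_range_succ]
    have hg' := congrArg (fun q : ℚ => ((q : ℚ) : ℚ_[2])) hg
    have hcb : ((c : ℚ) + 1) * (Nat.choose (2 * (c + 1)) (c + 1) : ℚ) = 2 * (2 * c + 1) * (Nat.choose (2 * c) c : ℚ) := by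
      have h1 := Nat.succ_mul_centralBinom_succ c
      rw [Nat.centralBinom_eq_two_mul_choose, Nat.centralBinom_eq_two_mul_choose] at h1
      rw [show 2 * (c + 1) = 2 * c + 2 by ring]; exact_mod_cast h1
    have hcb' := congrArg (fun q : ℚ => ((q : ℚ) : ℚ_[2])) hcb
    have hC : ((Nat.choose (2 * c) c : ℕ) : ℚ_[2]) ≠ 0 := by exact_mod_cast (Nat.choose_pos (by omega)).ne'
    have hc1 : ((c : ℚ_[2]) + 1) ≠ 0 := by
      have h' := natCast_ne_zero_padic (c + 1) (by omega); push_cast at h'; exact h'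
    have hodd := twoN_add_one_ne_zero_padic c
    push_cast at hg' hcb'
    have hcb'' : ((Nat.choose (2 * (c + 1)) (c + 1) : ℕ) : ℚ_[2])
        = 2 * (2 * c + 1) * ((Nat.choose (2 * c) c : ℕ) : ℚ_[2]) / (c + 1) := by
      rw [eq_div_iff hc1, ← hcb']; ring
    -- the closed form satisfies the recursion (identity in a free variable `X`)
    have hF : ∀ X G : ℚ_[2],
        8 * ((Nat.choose (2 * c) c : ℕ) : ℚ_[2]) / 4 ^ c * (X - G)
          = 4 / (2 * (-((c : ℚ_[2]) + 1)) + 1)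
            + 2 * (-((c : ℚ_[2]) + 1)) / (2 * (-((c : ℚ_[2]) + 1)) + 1)
              * (8 * (2 * (2 * c + 1) * ((Nat.choose (2 * c) c : ℕ) : ℚ_[2]) / (c + 1)) / 4 ^ (c + 1)
                * (X - (G + 4 ^ c / (2 * (2 * c + 1) ^ 2 * ((Nat.choose (2 * c) c : ℕ) : ℚ_[2])))))
            - 8 * (-((c : ℚ_[2]) + 1)) / (2 * (-((c : ℚ_[2]) + 1)) + 1) ^ 2 := by
      intro X G
      rw [show (2 * (-((c : ℚ_[2]) + 1)) + 1) = -(2 * c + 1) by ring,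
        show (2 * (-((c : ℚ_[2]) + 1))) = -(2 * (c + 1)) by ring]
      have hm : (-(2 * (c : ℚ_[2]) + 1)) ≠ 0 := neg_ne_zero.mpr hodd
      have hn : (-(2 * ((c : ℚ_[2]) + 1))) ≠ 0 := neg_ne_zero.mpr (mul_ne_zero two_ne_zero hc1)
      have h4' : ((4 : ℚ_[2]) ^ (c + 1)) ≠ 0 := pow_ne_zero _ (by norm_num)
      field_simp; ring
    have hFi := hF xi ((gsumAtom c : ℚ) : ℚ_[2])
    rw [← hcb'', ← hg'] at hFi
    have hk : (2 * (-((c : ℚ_[2]) + 1)) / (2 * (-((c : ℚ_[2]) + 1)) + 1)) ≠ 0 := by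
      rw [show (2 * (-((c : ℚ_[2]) + 1)) + 1) = -(2 * c + 1) by ring,
        show (2 * (-((c : ℚ_[2]) + 1))) = -(2 * (c + 1)) by ring]
      exact div_ne_zero (neg_ne_zero.mpr (mul_ne_zero two_ne_zero hc1)) (neg_ne_zero.mpr hodd)
    have hkey : (2 * (-((c : ℚ_[2]) + 1)) / (2 * (-((c : ℚ_[2]) + 1)) + 1)) * S1 (-((c : ℤ) + 1) : ℤ)
        = (2 * (-((c : ℚ_[2]) + 1)) / (2 * (-((c : ℚ_[2]) + 1)) + 1))
          * (8 * ((Nat.choose (2 * (c + 1)) (c + 1) : ℕ) : ℚ_[2]) / 4 ^ (c + 1)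
              * (xi - ((gsumAtom (c + 1) : ℚ) : ℚ_[2]))) := by
      linear_combination hFi - h
    have := mul_left_cancel₀ hk hkey
    rw [this]

/-- **`S₂(a) = t_{a−1}·(W(a) − 8ξ)` for `a ≥ 1`.** -/
theorem S2_nat (a : ℕ) (ha : 1 ≤ a) :
    S2 a = ((tB (a - 1) : ℚ) : ℚ_[2]) * (((Watom a : ℚ) : ℚ_[2]) - 8 * xi) := by
  induction a, ha using Nat.le_induction with
  | base =>
    have h := S2_succ 0
    have hw : Watom 1 = 8 := Watom_small.1
    norm_num at h ⊢
    rw [h, S1_zero, tB_zero, hw]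
    push_cast; ring
  | succ a ha ih =>
    have h := S2_succ a
    have h1nat := S1_nat a ha
    have hw1 : ((wInc₁ a : ℚ) : ℚ_[2])
        = 8 * ((Nat.choose (2 * a) a : ℕ) : ℚ_[2]) / (4 ^ a * (2 * a + 1) ^ 2) := by
      unfold wInc₁; push_cast; ring
    have hw2 : ((wInc₂ a : ℚ) : ℚ_[2]) = 2 * ((sigmaAtom a : ℚ) : ℚ_[2]) / (a * (2 * a + 1)) := by
      unfold wInc₂; push_cast; ring
    push_cast at h ih h1nat ⊢
    rw [h, ih, h1nat, Watom_succ a ha]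
    push_cast
    rw [hw1, hw2, cast_choose_eq a ha, cast_tB_eq_pred a ha]
    have h1 := cast_tB_ne_zero (a - 1)
    have h2 := natCast_ne_zero_padic a ha
    have h3 := twoN_add_one_ne_zero_padic a
    have h4 : ((4 : ℚ_[2]) ^ a) ≠ 0 := pow_ne_zero _ (by norm_num)
    field_simp; ring

end Summit.KontsevichZagierPeriods.Zeta5Search.CatalanTwoAdicSeries
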